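import Literature.NumberTheory.Automorphic.QuaternionApproximableClosure
import Literature.NumberTheory.Automorphic.QuaternionNormOneConjugateNear
import Literature.NumberTheory.Automorphic.QuaternionCoordOrder
import HarnessLib

/-!
# Kneser's strong approximation theorem for `ℍ[K,a,b]¹` and the discharge of
# `coordOrder_heckeDoubleCoset`

Topic `NumberTheory/Automorphic`; the proofs file of `QuaternionCoordOrder`: theorems only,
culminating in the discharge `QuaternionAlgebra.coordOrder_heckeDoubleCoset_holds` of the named
fact `QuaternionAlgebra.coordOrder_heckeDoubleCoset` (Vignéras, LNM 800, Ch. II §2 Thm. 2.3,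
III §4 Thm. 4.3 (Kneser), §5; Shimura 1971 Prop. 3.1).

The companion files reduced the fact to **Kneser's strong approximation theorem** in the
finite-adelic coordinate form `SA_f` (`QuaternionCoordOrderAdelicLiftProofs`: for `a, b ≠ 0` with
`ℍ[K,a,b]` not totally definite, `ι(ℍ¹)` is dense in `ℍ[𝔸_K^∞,a,b]¹`), `SA_f` to the
approximability of the norm-one elements supported at one place
(`QuaternionFiniteAdeleSinglePlaceReduction`), and that to the existence of conjugates of global
norm-one elements in every box around such an element (`QuaternionApproximableClosure`), which is
the main step `QuaternionNormOneConjugateNear.exists_normOne_conj_near` of Vignéras's proof of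
Thm. III.4.3. This file assembles: `extendOne_mem_approximable`, `finiteAdele_dense` (`= SA_f`,
Kneser's theorem with `S = ∞` in coordinates) and `coordOrder_heckeDoubleCoset_holds`.

## References

* M.-F. Vignéras, *Arithmétique des algèbres de quaternions*, LNM 800 (1980), Ch. III §4
  Thm. 4.3 and its proof, §5; Ch. II §2 Thm. 2.3 [VignerasLNM800].
* G. Shimura, *Introduction to the arithmetic theory of automorphic functions* (1971), §3.1,
  Prop. 3.1 [Shimura1971].
-/

noncomputable section

open scoped Quaternion Pointwise
open NumberField IsDedekindDomain

namespace Literature.NumberTheory.Automorphic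

namespace QuaternionAlgebra

/-! ### Kneser's theorem in coordinates; the discharge of `coordOrder_heckeDoubleCoset` -/

section Final

/-- `ℍ⟮K; R; a, b⟯ := ℍ[K, algebraMap R K a, algebraMap R K b]` (file-local notation, as in
`QuaternionCoordOrder`). -/
local notation "ℍ⟮" K "; " R "; " a ", " b "⟯" =>
  QuaternionAlgebra K (algebraMap R K a) (0 : K) (algebraMap R K b)

variable {K : Type} [Field K] [NumberField K] (a b : 𝓞 K)

/-- `𝔸_K^∞`. -/
local notation "𝔸ᶠ" => FiniteAdeleRing (𝓞 K) K

/-- `K_w`. -/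
local notation "K_" w => HeightOneSpectrum.adicCompletion K w

/-- `𝒪_w`. -/
local notation "𝒪_" w => HeightOneSpectrum.adicCompletionIntegers K w

/-- **The norm-one elements supported at one place are approximable** (Vignéras III §4, proof of
Thm. 4.3, for `ℍ[K,a,b]` not totally definite and `a b ≠ 0`): for every finite place `w₀` and
`g ∈ ℍ[K_{w₀},a,b]` with `g ḡ = 1`, the element `(g at w₀, 1 elsewhere)` of `ℍ[𝔸_K^∞,a,b]¹` lies in
the closure `𝓐` of `ι(ℍ¹)` (`exists_normOne_conj_near` and
`extendOne_mem_approximable_of_forall_conj`). [cite: VignerasLNM800, Ch. III §4 Thm. 4.3 (proof)] -/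
theorem extendOne_mem_approximable (ha : a ≠ 0) (hb : b ≠ 0)
    (hdef : ¬ IsTotallyDefinite K ℍ⟮K; 𝓞 K; a, b⟯) (w₀ : HeightOneSpectrum (𝓞 K))
    (g : ℍ⟮K_ w₀; 𝒪_ w₀; algebraMap (𝓞 K) (𝒪_ w₀) a, algebraMap (𝓞 K) (𝒪_ w₀) b⟯)
    (hg : g * star g = 1) : extendOne a b w₀ g ∈ approximable a b :=
  extendOne_mem_approximable_of_forall_conj a b ha hb w₀ g fun _ hV h0 =>
    exists_normOne_conj_near a b ha hb hdef w₀ g hg hV h0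

/-- **Kneser's strong approximation theorem for `ℍ[K,a,b]¹`, finite-adelic coordinate form `SA_f`**
(Vignéras III §4 Thm. 4.3 with `S = ∞`, Eichler's condition = not totally definite): for `a, b ≠ 0`
with `ℍ[K,a,b]` not totally definite, every `y ∈ ℍ[𝔸_K^∞,a,b]` with `y ȳ = 1` is approximated, in
all four coordinates and to within any open `V ∋ 0` of `𝔸_K^∞`, by the diagonal image of some
`x ∈ ℍ[K,a,b]` with `x x̄ = 1` (`finiteAdele_dense_of_forall_extendOne` and
`extendOne_mem_approximable`). [cite: VignerasLNM800, Ch. III §4 Thm. 4.3] -/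
theorem finiteAdele_dense (ha : a ≠ 0) (hb : b ≠ 0) (hdef : ¬ IsTotallyDefinite K ℍ⟮K; 𝓞 K; a, b⟯) :
    ∀ y : ℍ⟮𝔸ᶠ; 𝓞 K; a, b⟯, y * star y = 1 →
      ∀ V : Set 𝔸ᶠ, IsOpen V → (0 : 𝔸ᶠ) ∈ V →
        ∃ x : ℍ⟮K; 𝓞 K; a, b⟯, x * star x = 1 ∧ algebraMap K 𝔸ᶠ x.re - y.re ∈ V ∧
          algebraMap K 𝔸ᶠ x.imI - y.imI ∈ V ∧ algebraMap K 𝔸ᶠ x.imJ - y.imJ ∈ V ∧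
          algebraMap K 𝔸ᶠ x.imK - y.imK ∈ V :=
  finiteAdele_dense_of_forall_extendOne a b fun w t ht => extendOne_mem_approximable a b ha hb hdef w t ht

/-- **Discharge of the named fact `QuaternionAlgebra.coordOrder_heckeDoubleCoset`** (Vignéras
II §2 Thm. 2.3, III §4 Thm. 4.3 (Kneser), §5 Prop. 5.1, Cor. 5.3, IV §1; Shimura 1971 Prop. 3.1):
for a number field `K`, `a, b ∈ 𝓞 K ∖ 0` with `ℍ[K,a,b]` not totally definite, a principal finite
place `v = (ϖ)` with `v ∤ 2ab` and `g ∈ O = 𝓞_K⟨1,i,j,k⟩` with `g ḡ = ϖ`: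
`O^× g O^× = {x ∈ O : x x̄ ∈ 𝓞_K^× ϖ}` and `[O^× : O^× ∩ g⁻¹ O^× g] = q_v + 1` — by
`coordOrder_heckeDoubleCoset_of_forall_finiteAdele_dense` (the reduction of the companion files:
structure of `O/vO ≅ M₂(𝔽_v)`, Hensel lifting, local–global dictionary) and Kneser's theorem
`finiteAdele_dense`. [cite: VignerasLNM800, Ch. II §2 Thm. 2.3; Ch. III §4 Thm. 4.3, §5 Prop. 5.1 and Cor. 5.3; Ch. IV §1 Thm. 1.1 (2)] [cite: Shimura1971, Prop. 3.1] -/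
theorem coordOrder_heckeDoubleCoset_holds : coordOrder_heckeDoubleCoset :=
  coordOrder_heckeDoubleCoset_of_forall_finiteAdele_dense fun _ _ _ a b ha hb hdef =>
    finiteAdele_dense a b ha hb hdef

end Final


end QuaternionAlgebra

end Literature.NumberTheory.Automorphic
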